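import Mathlib
import HarnessLib
import Summits.NavierStokesRegularity.NavierStokesRegularity.Theorems.PoloidalWindowDoorLrcModEntireJetCertRelabel

/-!
# Route `PoloidalWindowDoor`, item `LrcModEntire` (stmt-NavierStokesRegularity-20428) — certificate checker: the relabeling check SPLIT INTO PARTS
# (one Boolean per direction + laws + pins), so that large dictionaries are certified in several `native_decide` files

Cell ns-regularity-ideate, seat ns-poloidal-K2-p3 gen 8 (LEAD of item 20428; `--supports stmt-NavierStokesRegularity-20428`).  `…JetCertRelabel.relabelCheck` is one
Boolean; for the slice dictionaries with the letter ranges the engines' block-13 / weight-11 generators need (D ≤ 11), its single `native_decide` runs 10–30 min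
on the farm.  Here the same check is cut into `relabelCheckDir R j` (table transfer, direction `j`), `relabelCheckHyps`, `relabelCheckPins`, and
`relabelCheck_of_parts` reassembles them; `LocalDatum.relabel_of_parts` is the corresponding soundness statement.  WHAT THIS IS NOT: not a claim about Navier–Stokes.
[folklore]
-/

noncomputable section

-- the summit and its single sub-problem share the name (CONVENTIONS §1), as in every Theorems file
set_option linter.dupNamespace false

namespace Summit.NavierStokesRegularity.NavierStokesRegularity.Theorems.PoloidalWindowDoorLrcModEntireJetCertRelabelParts

open Literature.Analysis.ValidatedNumerics Literature.Analysis.ValidatedNumerics.QMvPoly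
open Summit.NavierStokesRegularity.NavierStokesRegularity.Theorems.PoloidalWindowDoorLrcModEntireJetCertDefs
open Summit.NavierStokesRegularity.NavierStokesRegularity.Theorems.PoloidalWindowDoorLrcModEntireJetCertMasked
open Summit.NavierStokesRegularity.NavierStokesRegularity.Theorems.PoloidalWindowDoorLrcModEntireJetCertTree
open Summit.NavierStokesRegularity.NavierStokesRegularity.Theorems.PoloidalWindowDoorLrcModEntireJetCertFast2
open Summit.NavierStokesRegularity.NavierStokesRegularity.Theorems.PoloidalWindowDoorLrcModEntireJetCertRelabel

variable {E : Type*} [NormedAddCommGroup E] [NormedSpace ℝ E] {n : ℕ}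

/-- Table-transfer check for ONE direction `j`. [folklore] -/
def relabelCheckDir (n : ℕ) (S : ℕ → ℕ → QMvPoly) (M : ℕ → ℕ → Bool) (hyps : List QMvPoly) (R : RelabelData) (j : ℕ) : Bool :=
  (List.range R.m).all fun a =>
    !(R.Mf j a) ||
      (usesOnlyTabled n (M j) (R.Tf a) &&
        (let c := (R.tab.getD j []).getD a ([], 0)
         certCheckS n S M hyps c.1 c.2 (subQ (tderiv n (S j) (R.Tf a)) (compQ R.m R.Tf (R.Sf j a)))))

/-- Law-transfer check. [folklore] -/
def relabelCheckHyps (n : ℕ) (S : ℕ → ℕ → QMvPoly) (M : ℕ → ℕ → Bool) (hyps : List QMvPoly) (R : RelabelData) : Bool :=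
  (List.range R.hyps'.length).all fun i =>
    let c := R.hyp.getD i ([], 0)
    certCheckS n S M hyps c.1 c.2 (compQ R.m R.Tf (R.hyps'.getD i []))

/-- Pin-transfer check. [folklore] -/
def relabelCheckPins (n : ℕ) (S : ℕ → ℕ → QMvPoly) (M : ℕ → ℕ → Bool) (hyps pins : List QMvPoly) (R : RelabelData) : Bool :=
  decide (R.pin.length = R.pins'.length) &&
    ((List.range R.pins'.length).all fun i =>
      let ec := R.pin.getD i ([], ([], 0))
      certCheckS n S M hyps ec.2.1 ec.2.2 (subQ (compQ R.m R.Tf (R.pins'.getD i [])) (pinProduct pins ec.1)))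

/-- **REASSEMBLY**: the per-direction, law and pin parts give `relabelCheck`. [folklore] -/
theorem relabelCheck_of_parts {S : ℕ → ℕ → QMvPoly} {M : ℕ → ℕ → Bool} {hyps pins : List QMvPoly} (R : RelabelData)
    (hdir : ∀ j < R.M'.length, relabelCheckDir n S M hyps R j = true) (hh : relabelCheckHyps n S M hyps R = true)
    (hp : relabelCheckPins n S M hyps pins R = true) : relabelCheck n S M hyps pins R = true := by
  have hd : ((List.range R.M'.length).all fun j => relabelCheckDir n S M hyps R j) = true :=
    List.all_eq_true.2 fun j hj => hdir j (List.mem_range.1 hj)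
  unfold relabelCheck
  simp only [Bool.and_eq_true]
  exact ⟨⟨by simpa [relabelCheckDir] using hd, by simpa [relabelCheckHyps] using hh⟩, by simpa [relabelCheckPins] using hp⟩

/-- **RELABELING FROM PARTS** (soundness = `…JetCertRelabel.LocalDatum.relabel`). [folklore] -/
theorem LocalDatum.relabel_of_parts {S : ℕ → ℕ → QMvPoly} {M : ℕ → ℕ → Bool} {v : ℕ → E} {hyps pins : List QMvPoly} (R : RelabelData)
    (hdir : ∀ j < R.M'.length, relabelCheckDir n S M hyps R j = true) (hh : relabelCheckHyps n S M hyps R = true)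
    (hp : relabelCheckPins n S M hyps pins R = true) (hdat : LocalDatum (E := E) n S M v hyps pins) :
    LocalDatum (E := E) R.m R.Sf R.Mf v R.hyps' R.pins' :=
  LocalDatum.relabel R (relabelCheck_of_parts R hdir hh hp) hdat

/-- Four directions: the hypothesis `∀ j < 4` from four facts. [folklore] -/
theorem forall_lt_four {P : ℕ → Prop} (h0 : P 0) (h1 : P 1) (h2 : P 2) (h3 : P 3) : ∀ j < 4, P j := by
  intro j hj
  interval_cases j <;> assumption

end Summit.NavierStokesRegularity.NavierStokesRegularity.Theorems.PoloidalWindowDoorLrcModEntireJetCertRelabelParts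

end
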